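import Literature.NumberTheory.ComplexMultiplication.DadeTausskyZassenhausCubicOrderThreeClasses
import Literature.LinearAlgebra.Matrix.LatimerMacDuffeeRegularMatrices
import HarnessLib

/-!
# HL26b §8 for `β³ + 2β² + 2β + 2 = 0`: the `ε`-classes of full lattices `L ⊂ K = ℚ(β)` with `2β·L ⊆ L` are EXACTLY SIX

Hertling–Larabi [HL26b, §8, chunk p0024]: «Theorem 6.2 and Lemma 8.1 (a) tell that there is a 1:1 correspondence between
the set of `GL_3(ℤ)`-conjugacy classes of matrices with characteristic polynomial `f` and the set
`{[L]_ε | L ∈ 𝓛(A), 𝒪(L) ⊃ Λ_4}` of `𝓔(A)`. It will turn out to have six elements.» (chunk p0026: «They are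
representatives of the six `GL_3(ℤ)`-conjugacy classes of integer matrices with characteristic polynomial
`t³ + 4t² + 8t + 16`.»)

THIS FILE ASSEMBLES THE LATTICE SIDE: for the cubic field `K = ℚ(θ)`, `θ³ + 2θ² + 2θ + 2 = 0`, the `ε`-classes
(orbits under `K^{unit}`) of full lattices `L` with `2θ·L ⊆ L` — equivalently `𝒪(L) ⊇ ℤ[2θ] = Λ₄` — number
`1 + 1 + 2 + 2 = 6`: by Lemma 8.1 (`eq_of_isOrder`) the order `𝒪(L) = L:L` is one of `Λ₁, Λ₂, Λ₃, Λ₄`, the order is a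
`K^{unit}`-invariant, and over the four orders the classes number `1` (`natCard_quot_span₁_eq_one`), `1`
(`natCard_quot_span₂_eq_one`), `2` (`natCard_quot_span₃_eq_two`: `[Λ₃], [L₃]`), `2` (`natCard_quot_span₄_eq_two`:
`[Λ₄], [L₄]`).  §4 transfers the count to MATRICES through HL Thm. 6.2 = Latimer–MacDuffee (the tree's
`LatimerMacDuffeeRegular.exists_equiv_quot_conj_quot_units_smul`, applied to `A = ℚ[t]/(t³ + 4t² + 8t + 16) = ℚ(2β)`).

* §1 `div_self_eq_or_of_stable` (the order of a `2θ`-stable full lattice is `Λ₁, Λ₂, Λ₃` or `Λ₄`) and the converse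
  `stable_of_div_self_eq`.
* §2 (private) `natCard_quot_or` (classes of a disjoint `K^{unit}`-invariant union add up).
* §3 **`natCard_quot_stable_eq_six`**.
* §4 `irreducible_polyQ_four_eight_sixteen` and **`natCard_quot_conj_eq_six`**: the `GL₃(ℤ)`-conjugacy classes
  (`PB = B'P`, `det P = ±1`) of integer `3 × 3` matrices `B` with `minpoly_ℚ B = t³ + 4t² + 8t + 16` (equivalently, `g`
  being irreducible of degree `3`, with characteristic polynomial `g`) are EXACTLY SIX — HL §8's headline, whose six
  representatives `M_{Λ₁}, …, M_{L₄}` are pairwise non-conjugate by `LinearAlgebra/Matrix/GL3ZDadeTausskyZassenhausSixClasses`;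
  `charpoly_eq_iff_minpoly_eq` and **`natCard_quot_conj_charpoly_eq_six`** restate it with the characteristic polynomial
  over `ℤ`, as printed.

## References
* [HL26b] C. Hertling, K. Larabi, arXiv:2602.15748 (2026), §8 (chunks p0024–p0026), §6 Thm. 6.2. [HertlingLarabi2026b]
-/

noncomputable section

open scoped Pointwise
open Polynomial Module NumberField Submodule

namespace Literature.NumberTheory.ComplexMultiplication.FiniteQAlgebraLattice.DTZCubic

open Literature.NumberTheory.NumberFields
open Literature.NumberTheory.Automorphic (IsFullLattice mem_units_smul_submodule_iff)

variable {K : Type} [Field K] [NumberField K] {θ : K}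

/-! ## §1 The order of a `2θ`-stable full lattice -/

omit [NumberField K] in
/-- A multiplicatively closed `ℤ`-lattice containing `1` and `a` contains `ℤ[a]`. [folklore] -/
private theorem toSubmodule_adjoin_le' {Λ : Submodule ℤ K} (h1 : (1 : K) ∈ Λ) (hmul : Λ * Λ ≤ Λ) {a : K}
    (ha : a ∈ Λ) : Subalgebra.toSubmodule (Algebra.adjoin ℤ {a}) ≤ Λ := by
  let S : Subalgebra ℤ K :=
    { carrier := Λ
      mul_mem' := fun hx hy => hmul (Submodule.mul_mem_mul hx hy)
      one_mem' := h1
      add_mem' := fun hx hy => Λ.add_mem hx hy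
      zero_mem' := Λ.zero_mem
      algebraMap_mem' := fun n => by
        rw [Algebra.algebraMap_eq_smul_one]
        exact Λ.smul_mem n h1 }
  have h : Algebra.adjoin ℤ {a} ≤ S := Algebra.adjoin_le (Set.singleton_subset_iff.2 ha)
  exact fun x hx => h hx

/-- **LEMMA 8.1 for stable lattices: the order `𝒪(L) = L:L` of a full lattice `L` with `2θ·L ⊆ L` is `Λ₁, Λ₂, Λ₃` or
`Λ₄`** (`𝒪(L) ⊇ ℤ[2θ] = Λ₄` is a finitely generated order; `eq_of_isOrder`).
[cite: HertlingLarabi2026b, §8 Lemma 8.1 and «`{[L]_ε | 𝒪(L) ⊃ Λ_4}`», chunk p0024] -/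
theorem div_self_eq_or_of_stable (hθ : aeval θ (MonicCubic.poly 2 2 2) = 0) (h3 : finrank ℚ K = 3)
    {L : Submodule ℤ K} (hL : IsFullLattice K L) (hst : ∀ x ∈ L, 2 * θ * x ∈ L) :
    L / L = span ℤ ({1, θ, θ ^ 2} : Set K) ∨ L / L = span ℤ ({1, 2 * θ, θ ^ 2} : Set K) ∨
      L / L = span ℤ ({1, 2 * θ, 2 * θ ^ 2} : Set K) ∨ L / L = span ℤ ({1, 2 * θ, 4 * θ ^ 2} : Set K) := by
  have hO1 : (1 : K) ∈ L / L := mem_div_iff_forall_mul_mem.2 fun x hx => by rw [one_mul]; exact hx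
  have hOO : (L / L) * (L / L) ≤ L / L := div_mul_div_le_div_self L L
  have h2θ : 2 * θ ∈ L / L := mem_div_iff_forall_mul_mem.2 hst
  have h₄ : span ℤ ({1, 2 * θ, 4 * θ ^ 2} : Set K) ≤ L / L := by
    rw [span₄_eq_toSubmodule_adjoin hθ]
    exact toSubmodule_adjoin_le' hO1 hOO h2θ
  exact eq_of_isOrder hθ h3 (isFullLattice_div hL hL).1 h₄ hOO

omit [NumberField K] in
/-- Conversely a full lattice whose order is one of `Λ₁, Λ₂, Λ₃, Λ₄` is `2θ`-stable (`2θ ∈ Λ₄ ⊆ Λᵢ = L:L`).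
[cite: HertlingLarabi2026b, §8 («`𝒪(L) ⊃ Λ_4`»), chunk p0024] -/
theorem stable_of_div_self_eq {L : Submodule ℤ K}
    (hO : L / L = span ℤ ({1, θ, θ ^ 2} : Set K) ∨ L / L = span ℤ ({1, 2 * θ, θ ^ 2} : Set K) ∨
      L / L = span ℤ ({1, 2 * θ, 2 * θ ^ 2} : Set K) ∨ L / L = span ℤ ({1, 2 * θ, 4 * θ ^ 2} : Set K)) :
    ∀ x ∈ L, 2 * θ * x ∈ L := by
  have h2θ4 : 2 * θ ∈ span ℤ ({1, 2 * θ, 4 * θ ^ 2} : Set K) := subset_span (by simp)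
  have h2θ : 2 * θ ∈ L / L := by
    rcases hO with h | h | h | h <;> rw [h]
    · exact span₂_le_span₁ θ (span₃_le_span₂ θ (span₄_le_span₃ θ h2θ4))
    · exact span₃_le_span₂ θ (span₄_le_span₃ θ h2θ4)
    · exact span₄_le_span₃ θ h2θ4
    · exact h2θ4
  exact mem_div_iff_forall_mul_mem.1 h2θ

/-! ## §2 Classes of a disjoint invariant union add up -/

omit [NumberField K] in
/-- The relation `∃ u : Kˣ, u • L = L'` is an equivalence relation on any set of lattices. [folklore] -/
private theorem equivalence_units_smul' (P : Submodule ℤ K → Prop) :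
    Equivalence fun M M' : {M : Submodule ℤ K // P M} => ∃ u : Kˣ, u • M.1 = M'.1 where
  refl M := ⟨1, one_smul _ _⟩
  symm := by
    rintro M M' ⟨u, hu⟩
    exact ⟨u⁻¹, by rw [← hu, inv_smul_smul]⟩
  trans := by
    rintro M M' M'' ⟨u, hu⟩ ⟨v, hv⟩
    exact ⟨v * u, by rw [mul_smul, hu, hv]⟩

omit [NumberField K] in
/-- **`ε`-classes of a disjoint union of two `K^{unit}`-invariant families of lattices add up.** [folklore] -/
private theorem natCard_quot_or {P₁ P₂ : Submodule ℤ K → Prop} (h₁ : ∀ (u : Kˣ) (L : Submodule ℤ K), P₁ L → P₁ (u • L))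
    (hd : ∀ L, P₁ L → ¬ P₂ L)
    (hf₁ : Finite (Quot fun L L' : {L : Submodule ℤ K // P₁ L} => ∃ u : Kˣ, u • L.1 = L'.1))
    (hf₂ : Finite (Quot fun L L' : {L : Submodule ℤ K // P₂ L} => ∃ u : Kˣ, u • L.1 = L'.1)) :
    Nat.card (Quot fun L L' : {L : Submodule ℤ K // P₁ L ∨ P₂ L} => ∃ u : Kˣ, u • L.1 = L'.1) =
      Nat.card (Quot fun L L' : {L : Submodule ℤ K // P₁ L} => ∃ u : Kˣ, u • L.1 = L'.1) +
        Nat.card (Quot fun L L' : {L : Submodule ℤ K // P₂ L} => ∃ u : Kˣ, u • L.1 = L'.1) := by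
  haveI := hf₁
  haveI := hf₂
  let Ψ : (Quot fun L L' : {L : Submodule ℤ K // P₁ L} => ∃ u : Kˣ, u • L.1 = L'.1) ⊕
      (Quot fun L L' : {L : Submodule ℤ K // P₂ L} => ∃ u : Kˣ, u • L.1 = L'.1) →
      Quot fun L L' : {L : Submodule ℤ K // P₁ L ∨ P₂ L} => ∃ u : Kˣ, u • L.1 = L'.1 :=
    Sum.elim
      (Quot.lift (fun L => Quot.mk _ ⟨L.1, Or.inl L.2⟩) fun L L' ⟨u, hu⟩ => Quot.sound ⟨u, hu⟩)
      (Quot.lift (fun L => Quot.mk _ ⟨L.1, Or.inr L.2⟩) fun L L' ⟨u, hu⟩ => Quot.sound ⟨u, hu⟩)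
  have hequiv := equivalence_units_smul' (K := K) (fun L => P₁ L ∨ P₂ L)
  have hrel : ∀ (L L' : {L : Submodule ℤ K // P₁ L ∨ P₂ L}),
      Quot.mk (fun L L' : {L : Submodule ℤ K // P₁ L ∨ P₂ L} => ∃ u : Kˣ, u • L.1 = L'.1) L = Quot.mk _ L' →
        ∃ u : Kˣ, u • L.1 = L'.1 := fun L L' h => (hequiv.eqvGen_iff).1 (Quot.eqvGen_exact h)
  have hΨ : Function.Bijective Ψ := by
    constructor
    · rintro (a | a) (b | b) h
      · induction a using Quot.ind with | _ L => ?_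
        induction b using Quot.ind with | _ L' => ?_
        obtain ⟨u, hu⟩ := hrel _ _ h
        exact congrArg Sum.inl (Quot.sound ⟨u, hu⟩)
      · induction a using Quot.ind with | _ L => ?_
        induction b using Quot.ind with | _ L' => ?_
        obtain ⟨u, hu⟩ := hrel _ _ h
        exact (hd _ (hu ▸ h₁ u L.1 L.2 : P₁ L'.1) L'.2).elim
      · induction a using Quot.ind with | _ L => ?_
        induction b using Quot.ind with | _ L' => ?_
        obtain ⟨u, hu⟩ := hrel _ _ h
        have hu' : u⁻¹ • L'.1 = L.1 := by rw [← (hu : u • L.1 = L'.1), inv_smul_smul]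
        exact (hd _ (hu' ▸ h₁ u⁻¹ L'.1 L'.2 : P₁ L.1) L.2).elim
      · induction a using Quot.ind with | _ L => ?_
        induction b using Quot.ind with | _ L' => ?_
        obtain ⟨u, hu⟩ := hrel _ _ h
        exact congrArg Sum.inr (Quot.sound ⟨u, hu⟩)
    · intro q
      induction q using Quot.ind with | _ L => ?_
      rcases L.2 with h | h
      · exact ⟨Sum.inl (Quot.mk _ ⟨L.1, h⟩), rfl⟩
      · exact ⟨Sum.inr (Quot.mk _ ⟨L.1, h⟩), rfl⟩
  rw [← Nat.card_eq_of_bijective Ψ hΨ, Nat.card_sum]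

/-! ## §3 Six classes -/

omit [NumberField K] in
/-- `uL` is a full lattice for a full lattice `L` and a unit `u`. [folklore] -/
private theorem isFullLattice_units_smul' (u : Kˣ) {L : Submodule ℤ K} (hL : IsFullLattice K L) :
    IsFullLattice K (u • L) := by
  refine ⟨?_, fun d => ?_⟩
  · rw [Units.smul_def]
    exact hL.1.map _
  · obtain ⟨n, hn, hnd⟩ := hL.2 ((u⁻¹ : Kˣ) • d)
    refine ⟨n, hn, ?_⟩
    rw [mem_units_smul_submodule_iff, smul_comm]
    exact hnd

omit [NumberField K] in
/-- Fullness and the order are `K^{unit}`-invariants. [folklore] -/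
private theorem invariant (Λ : Submodule ℤ K) (u : Kˣ) (L : Submodule ℤ K)
    (h : IsFullLattice K L ∧ L / L = Λ) : IsFullLattice K (u • L) ∧ (u • L) / (u • L) = Λ :=
  ⟨isFullLattice_units_smul' u h.1, by rw [div_self_units_smul, h.2]⟩

/-- **HL26b §8: «It will turn out to have six elements» — the `ε`-classes of full lattices `L ⊂ K` with `2θ·L ⊆ L`
(`𝒪(L) ⊇ Λ₄ = ℤ[2θ] = ℤ[α]`) are exactly six** (`[Λ₁], [Λ₂], [Λ₃], [L₃], [Λ₄], [L₄]`; by HL Thm. 6.2 these are the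
`GL₃(ℤ)`-conjugacy classes of integer matrices with characteristic polynomial `t³ + 4t² + 8t + 16`).
[cite: HertlingLarabi2026b, §8 («It will turn out to have six elements», «representatives of the six `GL_3(ℤ)`-conjugacy classes»), chunks p0024, p0026] -/
theorem natCard_quot_stable_eq_six (hθ : aeval θ (MonicCubic.poly 2 2 2) = 0) (h3 : finrank ℚ K = 3) :
    Nat.card (Quot fun L L' : {L : Submodule ℤ K // IsFullLattice K L ∧ ∀ x ∈ L, 2 * θ * x ∈ L} =>
      ∃ u : Kˣ, u • L.1 = L'.1) = 6 := by
  have hli := linearIndependent_one_theta_sq hθ h3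
  -- the four families
  let P : Submodule ℤ K → Submodule ℤ K → Prop := fun Λ L => IsFullLattice K L ∧ L / L = Λ
  have hinv : ∀ (Λ : Submodule ℤ K) (u : Kˣ) (L : Submodule ℤ K), P Λ L → P Λ (u • L) :=
    fun Λ u L h => invariant Λ u L h
  -- pairwise different orders
  obtain ⟨h12, h23, h34, h14⟩ := span_ne hli
  have h13 : span ℤ ({1, θ, θ ^ 2} : Set K) ≠ span ℤ ({1, 2 * θ, 2 * θ ^ 2} : Set K) := fun e => by
    have h : θ ∈ span ℤ ({1, 2 * θ, 2 * θ ^ 2} : Set K) := e ▸ subset_span (by simp)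
    have h' : ((0 : ℤ) : K) + (1 : ℤ) * θ + (0 : ℤ) * θ ^ 2 = θ := by push_cast; ring
    have := (mem_span₃_iff hli 0 1 0).1 (by rw [h']; exact h)
    omega
  have h24 : span ℤ ({1, 2 * θ, θ ^ 2} : Set K) ≠ span ℤ ({1, 2 * θ, 4 * θ ^ 2} : Set K) := fun e => by
    have h : θ ^ 2 ∈ span ℤ ({1, 2 * θ, 4 * θ ^ 2} : Set K) := e ▸ subset_span (by simp)
    have h' : ((0 : ℤ) : K) + (0 : ℤ) * θ + (1 : ℤ) * θ ^ 2 = θ ^ 2 := by push_cast; ring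
    have := (mem_span₄_iff hli 0 0 1).1 (by rw [h']; exact h)
    omega
  -- finiteness of the four quotients from their cardinalities
  have c1 := natCard_quot_span₁_eq_one hθ h3
  have c2 := natCard_quot_span₂_eq_one hθ h3
  have c3 := natCard_quot_span₃_eq_two hθ h3
  have c4 := natCard_quot_span₄_eq_two hθ h3
  have f1 := Nat.finite_of_card_ne_zero (c1 ▸ one_ne_zero)
  have f2 := Nat.finite_of_card_ne_zero (c2 ▸ one_ne_zero)
  have f3 := Nat.finite_of_card_ne_zero (c3 ▸ two_ne_zero)
  have f4 := Nat.finite_of_card_ne_zero (c4 ▸ two_ne_zero)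
  -- `Λ₁ ∪ Λ₂`
  have c12 := natCard_quot_or (P₁ := P (span ℤ ({1, θ, θ ^ 2} : Set K))) (P₂ := P (span ℤ ({1, 2 * θ, θ ^ 2} : Set K)))
    (hinv _) (fun L hL hL' => h12 (hL.2.symm.trans hL'.2)) f1 f2
  rw [c1, c2] at c12
  have f12 := Nat.finite_of_card_ne_zero (c12 ▸ (by norm_num : (1 + 1 : ℕ) ≠ 0))
  -- `Λ₃ ∪ Λ₄`
  have c34 := natCard_quot_or (P₁ := P (span ℤ ({1, 2 * θ, 2 * θ ^ 2} : Set K)))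
    (P₂ := P (span ℤ ({1, 2 * θ, 4 * θ ^ 2} : Set K)))
    (hinv _) (fun L hL hL' => h34 (hL.2.symm.trans hL'.2)) f3 f4
  rw [c3, c4] at c34
  have f34 := Nat.finite_of_card_ne_zero (c34 ▸ (by norm_num : (2 + 2 : ℕ) ≠ 0))
  -- all four
  have c1234 := natCard_quot_or
    (P₁ := fun L => P (span ℤ ({1, θ, θ ^ 2} : Set K)) L ∨ P (span ℤ ({1, 2 * θ, θ ^ 2} : Set K)) L)
    (P₂ := fun L => P (span ℤ ({1, 2 * θ, 2 * θ ^ 2} : Set K)) L ∨ P (span ℤ ({1, 2 * θ, 4 * θ ^ 2} : Set K)) L)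
    (fun u L h => h.imp (hinv _ u L) (hinv _ u L))
    (fun L hL hL' => by
      rcases hL with hL | hL <;> rcases hL' with hL' | hL'
      · exact h13 (hL.2.symm.trans hL'.2)
      · exact h14 (hL.2.symm.trans hL'.2)
      · exact h23 (hL.2.symm.trans hL'.2)
      · exact h24 (hL.2.symm.trans hL'.2))
    f12 f34
  rw [c12, c34] at c1234
  -- the stable lattices are exactly the union
  have hiff : ∀ L : Submodule ℤ K, (IsFullLattice K L ∧ ∀ x ∈ L, 2 * θ * x ∈ L) ↔
      ((P (span ℤ ({1, θ, θ ^ 2} : Set K)) L ∨ P (span ℤ ({1, 2 * θ, θ ^ 2} : Set K)) L) ∨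
        (P (span ℤ ({1, 2 * θ, 2 * θ ^ 2} : Set K)) L ∨ P (span ℤ ({1, 2 * θ, 4 * θ ^ 2} : Set K)) L)) := by
    intro L
    constructor
    · rintro ⟨hL, hst⟩
      rcases div_self_eq_or_of_stable hθ h3 hL hst with h | h | h | h
      · exact Or.inl (Or.inl ⟨hL, h⟩)
      · exact Or.inl (Or.inr ⟨hL, h⟩)
      · exact Or.inr (Or.inl ⟨hL, h⟩)
      · exact Or.inr (Or.inr ⟨hL, h⟩)
    · rintro ((⟨hL, h⟩ | ⟨hL, h⟩) | (⟨hL, h⟩ | ⟨hL, h⟩))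
      · exact ⟨hL, stable_of_div_self_eq (Or.inl h)⟩
      · exact ⟨hL, stable_of_div_self_eq (Or.inr (Or.inl h))⟩
      · exact ⟨hL, stable_of_div_self_eq (Or.inr (Or.inr (Or.inl h)))⟩
      · exact ⟨hL, stable_of_div_self_eq (Or.inr (Or.inr (Or.inr h)))⟩
  have hPeq : (fun L : Submodule ℤ K => IsFullLattice K L ∧ ∀ x ∈ L, 2 * θ * x ∈ L) =
      fun L => (P (span ℤ ({1, θ, θ ^ 2} : Set K)) L ∨ P (span ℤ ({1, 2 * θ, θ ^ 2} : Set K)) L) ∨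
        (P (span ℤ ({1, 2 * θ, 2 * θ ^ 2} : Set K)) L ∨ P (span ℤ ({1, 2 * θ, 4 * θ ^ 2} : Set K)) L) :=
    funext fun L => propext (hiff L)
  have key : Nat.card (Quot fun L L' : {L : Submodule ℤ K // IsFullLattice K L ∧ ∀ x ∈ L, 2 * θ * x ∈ L} =>
      ∃ u : Kˣ, u • L.1 = L'.1) =
      Nat.card (Quot fun L L' : {L : Submodule ℤ K //
        (P (span ℤ ({1, θ, θ ^ 2} : Set K)) L ∨ P (span ℤ ({1, 2 * θ, θ ^ 2} : Set K)) L) ∨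
          (P (span ℤ ({1, 2 * θ, 2 * θ ^ 2} : Set K)) L ∨ P (span ℤ ({1, 2 * θ, 4 * θ ^ 2} : Set K)) L)} =>
        ∃ u : Kˣ, u • L.1 = L'.1) := by
    have h : ∀ {Q Q' : Submodule ℤ K → Prop}, Q = Q' →
        Nat.card (Quot fun L L' : {L : Submodule ℤ K // Q L} => ∃ u : Kˣ, u • L.1 = L'.1) =
          Nat.card (Quot fun L L' : {L : Submodule ℤ K // Q' L} => ∃ u : Kˣ, u • L.1 = L'.1) := by
      rintro Q Q' rfl; rfl
    exact h hPeq
  rw [key, c1234]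

/-! ## §4 The six `GL₃(ℤ)`-conjugacy classes of integer matrices with characteristic polynomial `t³ + 4t² + 8t + 16` -/

/-- `t³ + 4t² + 8t + 16` (the characteristic polynomial of `α = 2β`) is irreducible over `ℚ`: it has no root modulo `3`.
[cite: HertlingLarabi2026b, §8 («`f = t³ + 4t² + 8t + 16`», the minimal polynomial of `α = 2β`), chunk p0024] -/
theorem irreducible_polyQ_four_eight_sixteen : Irreducible (MonicCubic.polyQ 4 8 16) := by
  have hnr : ∀ r : ZMod 3, r ^ 3 + ((4 : ℤ) : ZMod 3) * r ^ 2 + ((8 : ℤ) : ZMod 3) * r + ((16 : ℤ) : ZMod 3) ≠ 0 := by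
    decide
  haveI : Fact (Nat.Prime 3) := ⟨Nat.prime_three⟩
  exact MonicCubic.irreducible_polyQ_of_no_root 3 hnr

/-- **HL26b §8, the headline: the integer `3 × 3` matrices with characteristic polynomial
`f = t³ + 4t² + 8t + 16` (irreducible, so `minpoly_ℚ = f`) form EXACTLY SIX `GL₃(ℤ)`-conjugacy classes** — by HL
Thm. 6.2 (Latimer–MacDuffee) they correspond to the `ε`-classes of full lattices `L ⊂ A = ℚ[t]/(f) = ℚ(2β)` with
`t̄L ⊆ L`, counted by `natCard_quot_stable_eq_six` with `θ = t̄/2`, `θ³ + 2θ² + 2θ + 2 = 0`.  Their representatives are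
HL's `M_{Λ₁}, M_{Λ₂}, M_{Λ₃}, M_{L₃}, M_{Λ₄}, M_{L₄}` (pairwise non-conjugate:
`GL3ZDTZSixClasses.rep_conj_imp_eq`). [cite: HertlingLarabi2026b, §8 («They are representatives of the six `GL_3(ℤ)`-conjugacy classes of integer matrices with characteristic polynomial `t³ + 4t² + 8t + 16`»), chunk p0026] -/
theorem natCard_quot_conj_eq_six :
    Nat.card (Quot fun B B' : {B : Matrix (Fin 3) (Fin 3) ℤ //
        minpoly ℚ (B.map (Int.castRingHom ℚ)) = MonicCubic.polyQ 4 8 16} =>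
      ∃ P : Matrix (Fin 3) (Fin 3) ℤ, IsUnit P.det ∧ P * B.1 = B'.1 * P) = 6 := by
  haveI : Fact (Irreducible (MonicCubic.polyQ 4 8 16)) := ⟨irreducible_polyQ_four_eight_sixteen⟩
  have hne : MonicCubic.polyQ 4 8 16 ≠ 0 := (MonicCubic.monic_polyQ 4 8 16).ne_zero
  obtain ⟨Φ, -⟩ := Literature.LinearAlgebra.Matrix.LatimerMacDuffeeRegular.exists_equiv_quot_conj_quot_units_smul
    (MonicCubic.monic_polyQ 4 8 16) (MonicCubic.natDegree_polyQ 4 8 16)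
  rw [Nat.card_congr Φ]
  -- the lattice side: `K = A_f`, `θ = t̄/2`
  have h3 : finrank ℚ (AdjoinRoot (MonicCubic.polyQ 4 8 16)) = 3 := by
    rw [(AdjoinRoot.powerBasis hne).finrank, AdjoinRoot.powerBasis_dim, MonicCubic.natDegree_polyQ]
  have h0 : AdjoinRoot.root (MonicCubic.polyQ 4 8 16) ^ 3 + 4 * AdjoinRoot.root (MonicCubic.polyQ 4 8 16) ^ 2 +
      8 * AdjoinRoot.root (MonicCubic.polyQ 4 8 16) + 16 = 0 := by
    have h := AdjoinRoot.eval₂_root (MonicCubic.polyQ 4 8 16)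
    have h' : eval₂ ((AdjoinRoot.of (MonicCubic.polyQ 4 8 16)).comp (algebraMap ℤ ℚ))
        (AdjoinRoot.root (MonicCubic.polyQ 4 8 16)) (MonicCubic.poly 4 8 16) = 0 := by
      rw [← eval₂_map]; exact h
    simp only [MonicCubic.poly, eval₂_add, eval₂_mul, eval₂_C, eval₂_X_pow, eval₂_X] at h'
    simp only [map_ofNat] at h'
    exact h'
  have hθ : aeval (AdjoinRoot.root (MonicCubic.polyQ 4 8 16) / 2) (MonicCubic.poly 2 2 2) = 0 := by
    rw [Polynomial.aeval_def]
    simp only [MonicCubic.poly, eval₂_add, eval₂_mul, eval₂_C, eval₂_X_pow, eval₂_X]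
    simp only [map_ofNat]
    linear_combination (1 / 8 : AdjoinRoot (MonicCubic.polyQ 4 8 16)) * h0
  have h6 := natCard_quot_stable_eq_six (K := AdjoinRoot (MonicCubic.polyQ 4 8 16)) hθ (by convert h3)
  have h2 : (2 : AdjoinRoot (MonicCubic.polyQ 4 8 16)) * (AdjoinRoot.root (MonicCubic.polyQ 4 8 16) / 2) =
      AdjoinRoot.root (MonicCubic.polyQ 4 8 16) := mul_div_cancel₀ _ two_ne_zero
  rw [h2] at h6
  exact h6

/-- For the irreducible cubic `f = t³ + 4t² + 8t + 16`, an integer `3 × 3` matrix has characteristic polynomial `f` iff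
its minimal polynomial over `ℚ` is `f` (HL: for irreducible `f` every matrix with characteristic polynomial `f` is
regular). [cite: HertlingLarabi2026b, §6 Def./Lemma 6.1 (c) and §8, chunks p0012, p0026] -/
theorem charpoly_eq_iff_minpoly_eq (B : Matrix (Fin 3) (Fin 3) ℤ) :
    B.charpoly = X ^ 3 + C 4 * X ^ 2 + C 8 * X + C 16 ↔
      minpoly ℚ (B.map (Int.castRingHom ℚ)) = MonicCubic.polyQ 4 8 16 := by
  have hpoly : (X ^ 3 + C 4 * X ^ 2 + C 8 * X + C 16 : ℤ[X]) = MonicCubic.poly 4 8 16 := rfl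
  have hmapB : (B.map (Int.castRingHom ℚ)).charpoly = B.charpoly.map (Int.castRingHom ℚ) :=
    Matrix.charpoly_map B (Int.castRingHom ℚ)
  rw [hpoly]
  constructor
  · intro h
    have hch : (B.map (Int.castRingHom ℚ)).charpoly = MonicCubic.polyQ 4 8 16 := by
      rw [hmapB, h]; rfl
    exact (minpoly.eq_of_irreducible_of_monic irreducible_polyQ_four_eight_sixteen
      (by rw [← hch]; exact Matrix.aeval_self_charpoly _) (MonicCubic.monic_polyQ 4 8 16)).symm
  · intro h
    have hdvd : MonicCubic.polyQ 4 8 16 ∣ (B.map (Int.castRingHom ℚ)).charpoly := h ▸ Matrix.minpoly_dvd_charpoly _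
    have hch : (B.map (Int.castRingHom ℚ)).charpoly = MonicCubic.polyQ 4 8 16 :=
      Polynomial.eq_of_monic_of_dvd_of_natDegree_le (MonicCubic.monic_polyQ 4 8 16) (Matrix.charpoly_monic _) hdvd
        (by rw [Matrix.charpoly_natDegree_eq_dim, MonicCubic.natDegree_polyQ, Fintype.card_fin])
    apply Polynomial.map_injective (Int.castRingHom ℚ) Int.cast_injective
    rw [← hmapB, hch]; rfl

/-- **The same count with the characteristic polynomial over `ℤ`, as printed: the `GL₃(ℤ)`-conjugacy classes of
integer `3 × 3` matrices with characteristic polynomial `t³ + 4t² + 8t + 16` are exactly six.**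
[cite: HertlingLarabi2026b, §8 («six `GL_3(ℤ)`-conjugacy classes of integer matrices with characteristic polynomial `t³ + 4t² + 8t + 16`»), chunk p0026] -/
theorem natCard_quot_conj_charpoly_eq_six :
    Nat.card (Quot fun B B' : {B : Matrix (Fin 3) (Fin 3) ℤ // B.charpoly = X ^ 3 + C 4 * X ^ 2 + C 8 * X + C 16} =>
      ∃ P : Matrix (Fin 3) (Fin 3) ℤ, IsUnit P.det ∧ P * B.1 = B'.1 * P) = 6 := by
  have hPeq : (fun B : Matrix (Fin 3) (Fin 3) ℤ => B.charpoly = X ^ 3 + C 4 * X ^ 2 + C 8 * X + C 16) =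
      fun B => minpoly ℚ (B.map (Int.castRingHom ℚ)) = MonicCubic.polyQ 4 8 16 :=
    funext fun B => propext (charpoly_eq_iff_minpoly_eq B)
  have key : ∀ {Q Q' : Matrix (Fin 3) (Fin 3) ℤ → Prop}, Q = Q' →
      Nat.card (Quot fun B B' : {B : Matrix (Fin 3) (Fin 3) ℤ // Q B} =>
          ∃ P : Matrix (Fin 3) (Fin 3) ℤ, IsUnit P.det ∧ P * B.1 = B'.1 * P) =
        Nat.card (Quot fun B B' : {B : Matrix (Fin 3) (Fin 3) ℤ // Q' B} =>
          ∃ P : Matrix (Fin 3) (Fin 3) ℤ, IsUnit P.det ∧ P * B.1 = B'.1 * P) := by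
    rintro Q Q' rfl; rfl
  rw [key hPeq]
  exact natCard_quot_conj_eq_six

end Literature.NumberTheory.ComplexMultiplication.FiniteQAlgebraLattice.DTZCubic

end
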